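import Summits.KontsevichZagierPeriods.KontsevichZagierPeriods.Theses.FermatIsogeny
import Summits.KontsevichZagierPeriods.KontsevichZagierPeriods.Theses.TerasomaMultiplication
import Summits.KontsevichZagierPeriods.KontsevichZagierPeriods.Theorems.FermatIsogenyFermatSectorCompleteBridges
import Summits.KontsevichZagierPeriods.KontsevichZagierPeriods.Theorems.FermatIsogenyFermatSectorCompleteKernelForm
import Summits.KontsevichZagierPeriods.KontsevichZagierPeriods.Theorems.FermatIsogenyBetaLinearOfProduct
import Summits.KontsevichZagierPeriods.KontsevichZagierPeriods.Theorems.GammaHodgeSector.Negative.LoadBearing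
import Summits.KontsevichZagierPeriods.KontsevichZagierPeriods.Theorems.CompleteModGammaSector.Negative.LoadBearing

/-!
# Strategist r1 certificate — crux 5 `FermatIsogeny.FermatSectorComplete` (stmt-KontsevichZagierPeriods-14252)

Kernel-checked content behind the redirect strategist's (second-opinion) verdict; every proof is a few lines over LANDED
theorems (p143559 BetaLinearOfProduct, p143622 KernelForm, p144355 Bridges, the two `Negative/LoadBearing` files), so this
file adds no mathematics — it PINS the three facts the tribunal needs under one import:

* `summit_iff_betaProductSector_and_fermatSectorComplete` — **the theorem that makes the crux summit-strength** in the
  CONJUNCT reading (T1): `S ↔ (crux 4 ∧ crux 5)`.  Crux 5 is the imported complement of the route's own β-sector content;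
  with crux 4 in hand it IS the summit (`BetaLinearOfProduct.closes_without_betaLinear`), and it is a consequence of the
  summit (`KernelForm.of_summit`).
* `byNamePair_iff_summit` — the by-name split prepared for this crux (children = shared items stmt-14233
  `CompleteModGammaSector`, stmt-3742 `GammaHodgeSector`; glue = `Bridges.fermatSectorComplete_of_…`) has pieces that are
  JOINTLY summit-equivalent (TerasomaMultiplication's whole cone) while each piece alone is only a consequence of S
  (probes: piece → S / piece → crux FAIL 16/16 batteries; see the seat's `bc/probes_r1b.lean`, `bc/probes_r1c.lean`).
* `byNamePair_of_betaProduct_of_crux` / `crux_of_byNamePair` — modulo the route's own crux 4 the pair and the crux are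
  interderivable, so the split neither strengthens nor weakens what route FermatIsogeny must prove beyond its β-sector.
-/

namespace Summit.KontsevichZagierPeriods.FermatIsogeny.StrategistR1

open Summit.KontsevichZagierPeriods.KontsevichZagierPeriods.Theses
open Summit.KontsevichZagierPeriods.KontsevichZagierPeriods.Theses.FermatIsogeny
  (BetaLinearSector BetaProductSector FermatSectorComplete)
open Summit.KontsevichZagierPeriods.KontsevichZagierPeriods.Theses.TerasomaMultiplication
  (CompleteModGammaSector GammaHodgeSector)

/-- **T1 certificate (conjunct reading).** The summit is exactly crux 4 ∧ crux 5 of route FermatIsogeny: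
`→` by `KernelForm.of_summit` and `Bridges.summit_iff_betaProductSector_of_fermatSectorComplete`;
`←` by `BetaLinearOfProduct.closes_without_betaLinear` (crux 3 is a corollary of crux 4). [folklore] -/
theorem summit_iff_betaProductSector_and_fermatSectorComplete :
    _root_.KontsevichZagierPeriods ↔ (BetaProductSector ∧ FermatSectorComplete) := by
  constructor
  · intro h
    have h₅ : FermatSectorComplete := FermatSectorCompleteKernelForm.of_summit h
    exact ⟨(FermatSectorCompleteBridges.summit_iff_betaProductSector_of_fermatSectorComplete h₅).mp h, h₅⟩
  · rintro ⟨h₄, h₅⟩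
    exact BetaLinearOfProduct.closes_without_betaLinear h₄ h₅

/-- The glue of the prepared by-name split, re-exported: piece₁ → piece₂ → crux 5 (landed bridge p144355). [folklore] -/
theorem crux_of_byNamePair (h₁ : CompleteModGammaSector) (h₂ : GammaHodgeSector) : FermatSectorComplete :=
  FermatSectorCompleteBridges.fermatSectorComplete_of_completeModGammaSector_of_gammaHodgeSector h₁ h₂

/-- The two by-name pieces are JOINTLY summit-equivalent: `←` each piece is a consequence of S
(`CompleteModGammaSectorNegative.of_summit`, `GammaHodgeSectorNegative.of_summit`); `→` is route
TerasomaMultiplication's deciding theorem. [folklore] -/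
theorem byNamePair_iff_summit :
    (CompleteModGammaSector ∧ GammaHodgeSector) ↔ _root_.KontsevichZagierPeriods := by
  constructor
  · rintro ⟨h₁, h₂⟩
    exact TerasomaMultiplication.closes h₂ h₁
  · intro h
    exact ⟨CompleteModGammaSectorNegative.of_summit h, GammaHodgeSectorNegative.of_summit h⟩

/-- Modulo the route's own crux 4, crux 5 gives the by-name pair back (through the summit). [folklore] -/
theorem byNamePair_of_betaProduct_of_crux (h₄ : BetaProductSector) (h₅ : FermatSectorComplete) :
    CompleteModGammaSector ∧ GammaHodgeSector :=
  byNamePair_iff_summit.mpr (BetaLinearOfProduct.closes_without_betaLinear h₄ h₅)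

/-- Hence, given crux 4, the crux, the by-name pair and the summit are the same proposition. [folklore] -/
theorem crux_iff_byNamePair_of_betaProduct (h₄ : BetaProductSector) :
    FermatSectorComplete ↔ (CompleteModGammaSector ∧ GammaHodgeSector) :=
  ⟨byNamePair_of_betaProduct_of_crux h₄, fun h => crux_of_byNamePair h.1 h.2⟩

#print axioms summit_iff_betaProductSector_and_fermatSectorComplete
#print axioms byNamePair_iff_summit
#print axioms crux_iff_byNamePair_of_betaProduct

end Summit.KontsevichZagierPeriods.FermatIsogeny.StrategistR1
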